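import Summits.Ventures.DiscreteObjects.PP12.OrderThirteenShapeTables

/-!
# PP(12), order-13 cell: bit-level semantics of the kernel search primitives (masks, fields, rotations, difference masks)
Framing: lottery ticket; floor = certified bounds/negative ranges.

Cell pub-namedobj (venture DiscreteObjects), target (M), designs gen 20. The kernel search of `OrderThirteenShapeTables` manipulates naturals with
`Nat.land / lor / xor / shiftLeft / shiftRight`; this file states what those operations do bit by bit (`Nat.testBit`), and bridges 13-bit masks with
finsets of residues (`Shape13.maskOf` / `Shape13.setOf`): the mask of a translate is a rotation (`maskOf_image_add`), the mask of a difference set is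
`diffMask` (`maskOf_image₂_sub`), disjoint finsets have `land = 0`. Pure lemmas; no `sorry`, no new axioms.
-/

namespace Summit.Ventures.DiscreteObjects.PP12

namespace Shape13

open Finset

/-! ### notation bridges -/

/-- `Nat.land` is `&&&` -/ theorem land_def (a b : ℕ) : Nat.land a b = a &&& b := rfl
/-- `Nat.lor` is `|||` -/ theorem lor_def (a b : ℕ) : Nat.lor a b = a ||| b := rfl
/-- `Nat.xor` is `^^^` -/ theorem xor_def (a b : ℕ) : Nat.xor a b = a ^^^ b := rfl
/-- `Nat.shiftRight` is `>>>` -/ theorem shiftRight_def (a b : ℕ) : Nat.shiftRight a b = a >>> b := rfl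
/-- `Nat.shiftLeft` is `<<<` -/ theorem shiftLeft_def (a b : ℕ) : Nat.shiftLeft a b = a <<< b := rfl

/-- `Nat.beq` as a `decide` -/
theorem beq_eq_decide (a b : ℕ) : Nat.beq a b = decide (a = b) := by
  cases h : Nat.beq a b
  · have : ¬ a = b := fun e => by subst e; simp at h
    simp [this]
  · simp [Nat.beq_eq.mp h]

/-- `Nat.ble` as a `decide` -/
theorem ble_eq_decide (a b : ℕ) : Nat.ble a b = decide (a ≤ b) := by
  cases h : Nat.ble a b
  · have : ¬ a ≤ b := fun e => by rw [← Nat.ble_eq] at e; rw [e] at h; exact Bool.noConfusion h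
    simp [this]
  · simp [Nat.ble_eq.mp h]

/-- `Nat.blt` as a `decide` -/
theorem blt_eq_decide (a b : ℕ) : Nat.blt a b = decide (a < b) := by
  cases h : Nat.blt a b
  · have : ¬ a < b := fun e => by rw [← Nat.blt_eq] at e; rw [e] at h; exact Bool.noConfusion h
    simp [this]
  · simp [Nat.blt_eq.mp h]

/-- our `bit` is `Nat.testBit` -/
theorem bit_eq (x i : ℕ) : bit x i = x.testBit i := by
  unfold bit
  rw [land_def, shiftRight_def, Nat.and_one_is_mod, Nat.shiftRight_eq_div_pow, Nat.testBit_eq_decide_div_mod_eq, beq_eq_decide]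
  rcases Nat.mod_two_eq_zero_or_one (x / 2 ^ i) with h | h <;> simp [h]

/-! ### fields -/

/-- high bits of a small number vanish -/
theorem testBit_eq_false_of_lt_le {v n i : ℕ} (hv : v < 2 ^ n) (hi : n ≤ i) : v.testBit i = false :=
  Nat.testBit_eq_false_of_lt (lt_of_lt_of_le hv (Nat.pow_le_pow_right (by norm_num) hi))

/-- the bits of an assignment field -/
theorem testBit_aAt (A o j : ℕ) : (aAt A o).testBit j = (decide (j < 5) && A.testBit (o + j)) := by
  unfold aAt
  rw [land_def, shiftRight_def, Nat.testBit_land, Nat.testBit_shiftRight, show (31 : ℕ) = 2 ^ 5 - 1 from rfl, Nat.testBit_two_pow_sub_one,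
    Bool.and_comm]

/-- the bits of a domain field -/
theorem testBit_dAt (D o g : ℕ) : (dAt D o).testBit g = (decide (g < 27) && D.testBit (o + g)) := by
  unfold dAt
  rw [land_def, shiftRight_def, Nat.testBit_land, Nat.testBit_shiftRight, show (134217727 : ℕ) = 2 ^ 27 - 1 from rfl,
    Nat.testBit_two_pow_sub_one, Bool.and_comm]

/-- an assignment field is `< 32` -/
theorem aAt_lt (A o : ℕ) : aAt A o < 32 := by
  refine Nat.lt_pow_two_of_testBit (n := 5) _ fun i hi => ?_
  rw [testBit_aAt]; simp [Nat.not_lt.2 hi]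

/-- a domain field is empty iff its 27 bits are clear -/
theorem dAt_eq_zero_iff (D o : ℕ) : dAt D o = 0 ↔ ∀ g < 27, D.testBit (o + g) = false := by
  constructor
  · intro h g hg
    have := congrArg (fun x => Nat.testBit x g) h
    simp only [testBit_dAt, Nat.zero_testBit, hg, decide_true, Bool.true_and] at this
    exact this
  · intro h
    apply Nat.eq_of_testBit_eq
    intro g
    rw [testBit_dAt, Nat.zero_testBit]
    by_cases hg : g < 27
    · simp [hg, h g hg]
    · simp [hg]

/-- the candidate presence test reads one bit of the field -/
theorem beq_land_two_pow (f g : ℕ) : Nat.beq (Nat.land f (2 ^ g)) 0 = !f.testBit g := by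
  rw [beq_eq_decide, land_def]
  cases h : f.testBit g
  · simp only [Bool.not_false, decide_eq_true_eq]
    apply Nat.eq_of_testBit_eq
    intro i
    rw [Nat.testBit_land, Nat.testBit_two_pow, Nat.zero_testBit]
    by_cases hi : g = i
    · subst hi; simp [h]
    · simp [hi]
  · simp only [Bool.not_true, decide_eq_false_iff_not]
    intro e
    have := congrArg (fun x => Nat.testBit x g) e
    simp [h] at this

/-- clearing: `D xor (D land X)` keeps exactly the bits of `D` outside `X` -/
theorem testBit_clr (D X i : ℕ) : (Nat.xor D (Nat.land D X)).testBit i = (D.testBit i && !X.testBit i) := by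
  rw [xor_def, land_def, Nat.testBit_xor, Nat.testBit_land]
  cases D.testBit i <;> cases X.testBit i <;> rfl

/-- setting an EMPTY field by `lor`: the other aligned fields are unchanged… -/
theorem aAt_lor_shiftLeft_of_ne {A o o' v : ℕ} (hv : v < 32) (h : o + 5 ≤ o' ∨ o' + 5 ≤ o) :
    aAt (Nat.lor A (Nat.shiftLeft v o)) o' = aAt A o' := by
  apply Nat.eq_of_testBit_eq
  intro j
  rw [testBit_aAt, testBit_aAt, lor_def, shiftLeft_def, Nat.testBit_lor, Nat.testBit_shiftLeft]
  by_cases hj : j < 5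
  · simp only [hj, decide_true, Bool.true_and]
    have : (decide (o' + j ≥ o) && v.testBit (o' + j - o)) = false := by
      rcases h with h | h
      · have hvb : v.testBit (o' + j - o) = false := testBit_eq_false_of_lt_le (n := 5) hv (by omega)
        simp [hvb]
      · have : ¬ (o' + j ≥ o) := by omega
        simp [this]
    rw [this, Bool.or_false]
  · simp [hj]

/-- … and the field itself becomes `v` -/
theorem aAt_lor_shiftLeft_self {A o v : ℕ} (hv : v < 32) (h0 : aAt A o = 0) : aAt (Nat.lor A (Nat.shiftLeft v o)) o = v := by
  apply Nat.eq_of_testBit_eq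
  intro j
  rw [testBit_aAt, lor_def, shiftLeft_def, Nat.testBit_lor, Nat.testBit_shiftLeft]
  by_cases hj : j < 5
  · have hA : A.testBit (o + j) = false := by
      have := congrArg (fun x => Nat.testBit x j) h0
      simp only [testBit_aAt, hj, decide_true, Bool.true_and, Nat.zero_testBit] at this
      exact this
    simp [hj, hA, show o + j - o = j by omega]
  · have : v.testBit j = false := testBit_eq_false_of_lt_le (n := 5) hv (by omega)
    simp [hj, this]

/-! ### rotations -/

/-- `rot13 m c < 2¹³` -/
theorem rot13_lt (m c : ℕ) : rot13 m c < 2 ^ 13 := by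
  unfold rot13
  rw [land_def, show (8191 : ℕ) = 2 ^ 13 - 1 from rfl, Nat.and_two_pow_sub_one_eq_mod]
  exact Nat.mod_lt _ (by norm_num)

/-- **the bits of a rotation**: `rot13 m c` is the translate `m + c (mod 13)` of a 13-bit mask `m` (`c ≤ 13`) -/
theorem testBit_rot13 {m c i : ℕ} (hm : m < 2 ^ 13) (hc : c ≤ 13) (hi : i < 13) :
    (rot13 m c).testBit i = m.testBit ((i + 13 - c) % 13) := by
  unfold rot13
  rw [land_def, lor_def, shiftLeft_def, shiftRight_def, Nat.testBit_land, show (8191 : ℕ) = 2 ^ 13 - 1 from rfl,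
    Nat.testBit_two_pow_sub_one, Nat.testBit_lor, Nat.testBit_shiftLeft, Nat.testBit_shiftRight]
  simp only [hi, decide_true, Bool.and_true]
  by_cases hic : c ≤ i
  · have e : (i + 13 - c) % 13 = i - c := by
      rw [show i + 13 - c = (i - c) + 13 by omega, Nat.add_mod_right, Nat.mod_eq_of_lt (by omega)]
    have h2 : m.testBit (13 - c + i) = false :=
      Nat.testBit_eq_false_of_lt (lt_of_lt_of_le hm (Nat.pow_le_pow_right (by norm_num) (by omega)))
    rw [e, h2, Bool.or_false]
    simp [hic]
  · have e : (i + 13 - c) % 13 = 13 - c + i := by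
      rw [show i + 13 - c = 13 - c + i by omega, Nat.mod_eq_of_lt (by omega)]
    have : ¬ (i ≥ c) := hic
    simp [this, e]

/-- bits of a 13-bit mask beyond 13 -/
theorem testBit_eq_false_of_lt13 {m i : ℕ} (hm : m < 2 ^ 13) (hi : 13 ≤ i) : m.testBit i = false :=
  Nat.testBit_eq_false_of_lt (lt_of_lt_of_le hm (Nat.pow_le_pow_right (by norm_num) hi))

/-- rotating twice -/
theorem rot13_rot13 {m a b : ℕ} (hm : m < 2 ^ 13) (ha : a ≤ 13) (hb : b ≤ 13) : rot13 (rot13 m a) b = rot13 m ((a + b) % 13) := by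
  apply Nat.eq_of_testBit_eq
  intro i
  by_cases hi : i < 13
  · rw [testBit_rot13 (rot13_lt _ _) hb hi, testBit_rot13 hm ha (Nat.mod_lt _ (by norm_num)),
      testBit_rot13 hm (Nat.le_of_lt (Nat.mod_lt _ (by norm_num))) hi]
    congr 1
    omega
  · rw [testBit_eq_false_of_lt13 (rot13_lt _ _) (by omega), testBit_eq_false_of_lt13 (rot13_lt _ _) (by omega)]

/-- rotating by `0` -/
theorem rot13_zero {m : ℕ} (hm : m < 2 ^ 13) : rot13 m 0 = m := by
  apply Nat.eq_of_testBit_eq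
  intro i
  by_cases hi : i < 13
  · rw [testBit_rot13 hm (by norm_num) hi]; congr 1; omega
  · rw [testBit_eq_false_of_lt13 (rot13_lt _ _) (by omega), testBit_eq_false_of_lt13 hm (by omega)]

/-! ### difference masks -/

/-- the bits of `diffMaskAux` -/
theorem testBit_diffMaskAux {A B : ℕ} (hA : A < 2 ^ 13) {d : ℕ} (hd : d < 13) :
    ∀ {n : ℕ}, n ≤ 13 → ((diffMaskAux A B n).testBit d = true ↔ ∃ b < n, B.testBit b = true ∧ A.testBit ((d + b) % 13) = true)
  | 0, _ => by simp [diffMaskAux]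
  | n + 1, hn => by
    have ih : ((diffMaskAux A B n).testBit d = true ↔ ∃ b < n, B.testBit b = true ∧ A.testBit ((d + b) % 13) = true) :=
      testBit_diffMaskAux hA hd (by omega)
    unfold diffMaskAux
    rw [bit_eq]
    cases hB : B.testBit n
    · simp only [cond_false]
      rw [ih]
      constructor
      · rintro ⟨b, hb, h1, h2⟩; exact ⟨b, by omega, h1, h2⟩
      · rintro ⟨b, hb, h1, h2⟩
        rcases Nat.lt_succ_iff_lt_or_eq.1 hb with hb | rfl
        · exact ⟨b, hb, h1, h2⟩
        · rw [hB] at h1; exact absurd h1 (by simp)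
    · simp only [cond_true]
      rw [lor_def, Nat.testBit_lor, Bool.or_eq_true, ih, testBit_rot13 hA (by omega) hd,
        show (d + 13 - (13 - n)) % 13 = (d + n) % 13 by congr 1; omega]
      constructor
      · rintro (⟨b, hb, h1, h2⟩ | h)
        · exact ⟨b, by omega, h1, h2⟩
        · exact ⟨n, by omega, hB, h⟩
      · rintro ⟨b, hb, h1, h2⟩
        rcases Nat.lt_succ_iff_lt_or_eq.1 hb with hb | rfl
        · exact Or.inl ⟨b, hb, h1, h2⟩
        · exact Or.inr h2

/-- **the bits of a difference mask**: bit `d` of `diffMask A B` is set iff `b ∈ B` and `d + b ∈ A` for some residue `b` -/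
theorem testBit_diffMask {A B d : ℕ} (hA : A < 2 ^ 13) (hd : d < 13) :
    (diffMask A B).testBit d = true ↔ ∃ b < 13, B.testBit b = true ∧ A.testBit ((d + b) % 13) = true :=
  testBit_diffMaskAux hA hd le_rfl

/-- a difference mask is a 13-bit mask -/
theorem diffMask_lt (A B : ℕ) : diffMask A B < 2 ^ 13 := by
  suffices h : ∀ n, diffMaskAux A B n < 2 ^ 13 from h 13
  intro n
  induction n with
  | zero => simp [diffMaskAux]
  | succ n ih =>
    unfold diffMaskAux
    cases bit B n
    · exact ih
    · simp only [cond_true]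
      refine Nat.lt_pow_two_of_testBit _ fun i hi => ?_
      rw [lor_def, Nat.testBit_lor, Nat.testBit_eq_false_of_lt (lt_of_lt_of_le ih (Nat.pow_le_pow_right (by norm_num) hi)),
        testBit_eq_false_of_lt13 (rot13_lt _ _) hi, Bool.or_false]

/-! ### masks of finsets of residues -/

/-- the 13-bit mask of a set of residues -/
def maskOf (S : Finset (Fin 13)) : ℕ := ∑ x ∈ S, 2 ^ (x : ℕ)

/-- the set of residues of a mask -/
def setOf (m : ℕ) : Finset (Fin 13) := univ.filter fun x => m.testBit x

/-- folklore: bit `j` of `Σ_{i ∈ T} 2^i` is `[j ∈ T]` -/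
theorem testBit_sum_two_pow (T : Finset ℕ) (j : ℕ) : (∑ i ∈ T, 2 ^ i).testBit j = true ↔ j ∈ T := by
  have h1 : Finset.equivBitIndices (∑ i ∈ T, 2 ^ i) = T := Finset.equivBitIndices.apply_symm_apply T
  rw [Finset.equivBitIndices_apply] at h1
  constructor
  · intro h
    rw [← h1, List.mem_toFinset, Nat.mem_bitIndices]; exact h
  · intro h
    rw [← h1, List.mem_toFinset, Nat.mem_bitIndices] at h; exact h

/-- **the bits of `maskOf`** -/
theorem testBit_maskOf (S : Finset (Fin 13)) (j : ℕ) : (maskOf S).testBit j = true ↔ ∃ x ∈ S, (x : ℕ) = j := by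
  unfold maskOf
  rw [show ∑ x ∈ S, 2 ^ (x : ℕ) = ∑ i ∈ S.map Fin.valEmbedding, 2 ^ i by rw [Finset.sum_map]; rfl, testBit_sum_two_pow]
  simp

/-- membership through the mask -/
theorem testBit_maskOf_val (S : Finset (Fin 13)) (x : Fin 13) : (maskOf S).testBit x = true ↔ x ∈ S := by
  rw [testBit_maskOf]
  constructor
  · rintro ⟨y, hy, e⟩; rwa [← Fin.ext e]
  · intro h; exact ⟨x, h, rfl⟩

/-- `maskOf S < 2¹³` -/
theorem maskOf_lt (S : Finset (Fin 13)) : maskOf S < 2 ^ 13 := by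
  refine Nat.lt_pow_two_of_testBit _ fun i hi => ?_
  cases h : (maskOf S).testBit i
  · rfl
  · obtain ⟨x, -, e⟩ := (testBit_maskOf S i).1 h
    omega

/-- `maskOf` is injective -/
theorem maskOf_injective : Function.Injective maskOf := by
  intro S T h
  ext x
  rw [← testBit_maskOf_val, ← testBit_maskOf_val, h]

/-- `setOf` inverts `maskOf` -/
theorem setOf_maskOf (S : Finset (Fin 13)) : setOf (maskOf S) = S := by
  ext x
  simp [setOf, testBit_maskOf_val]

/-- `maskOf` inverts `setOf` on 13-bit masks -/
theorem maskOf_setOf {m : ℕ} (hm : m < 2 ^ 13) : maskOf (setOf m) = m := by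
  apply Nat.eq_of_testBit_eq
  intro i
  by_cases hi : i < 13
  · cases h : m.testBit i
    · cases h' : (maskOf (setOf m)).testBit i
      · rfl
      · obtain ⟨x, hx, e⟩ := (testBit_maskOf _ i).1 h'
        simp only [setOf, mem_filter, mem_univ, true_and] at hx
        rw [e] at hx; rw [hx] at h; exact h
    · exact (testBit_maskOf_val (setOf m) ⟨i, hi⟩).2 (by simpa [setOf] using h)
  · rw [testBit_eq_false_of_lt13 (maskOf_lt _) (by omega), testBit_eq_false_of_lt13 hm (by omega)]

/-- membership in `setOf` -/
@[simp] theorem mem_setOf (m : ℕ) (x : Fin 13) : x ∈ setOf m ↔ m.testBit x = true := by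
  simp [setOf]

/-- the cardinality of a set is read off its mask -/
theorem card_eq_card_setOf_maskOf (S : Finset (Fin 13)) : S.card = (setOf (maskOf S)).card := by
  rw [setOf_maskOf]

/-- **translation is rotation**: the mask of `x + S` is `rot13 (maskOf S) x` -/
theorem maskOf_image_add (S : Finset (Fin 13)) (x : Fin 13) : maskOf (S.image fun a => x + a) = rot13 (maskOf S) x := by
  apply Nat.eq_of_testBit_eq
  intro i
  by_cases hi : i < 13
  · rw [testBit_rot13 (maskOf_lt S) (Nat.le_of_lt x.isLt) hi]
    have key : (maskOf (S.image fun a => x + a)).testBit i = true ↔ (maskOf S).testBit ((i + 13 - x) % 13) = true := by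
      rw [testBit_maskOf_val S ⟨(i + 13 - x) % 13, Nat.mod_lt _ (by norm_num)⟩,
        show (maskOf (S.image fun a => x + a)).testBit i = (maskOf (S.image fun a => x + a)).testBit ((⟨i, hi⟩ : Fin 13) : ℕ) from rfl,
        testBit_maskOf_val, mem_image]
      constructor
      · rintro ⟨a, ha, e⟩
        convert ha using 1
        apply Fin.ext
        rw [Fin.ext_iff, Fin.val_add] at e
        dsimp only at e ⊢
        omega
      · intro h
        refine ⟨⟨(i + 13 - x) % 13, Nat.mod_lt _ (by norm_num)⟩, h, ?_⟩
        apply Fin.ext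
        rw [Fin.val_add]
        dsimp only
        omega
    cases h1 : (maskOf (S.image fun a => x + a)).testBit i <;> cases h2 : (maskOf S).testBit ((i + 13 - x) % 13)
    · rfl
    · exact absurd (key.2 h2) (by rw [h1]; simp)
    · exact absurd (key.1 h1) (by rw [h2]; simp)
    · rfl
  · rw [testBit_eq_false_of_lt13 (maskOf_lt _) (by omega), testBit_eq_false_of_lt13 (rot13_lt _ _) (by omega)]

/-- **difference sets are difference masks**: the mask of `{a − b : a ∈ S, b ∈ T}` is `diffMask (maskOf S) (maskOf T)` -/
theorem maskOf_image₂_sub (S T : Finset (Fin 13)) : maskOf (image₂ (fun a b => a - b) S T) = diffMask (maskOf S) (maskOf T) := by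
  apply Nat.eq_of_testBit_eq
  intro d
  by_cases hd : d < 13
  · have key : (maskOf (image₂ (fun a b => a - b) S T)).testBit d = true ↔ (diffMask (maskOf S) (maskOf T)).testBit d = true := by
      rw [testBit_diffMask (maskOf_lt S) hd,
        show (maskOf (image₂ (fun a b => a - b) S T)).testBit d = (maskOf (image₂ (fun a b => a - b) S T)).testBit ((⟨d, hd⟩ : Fin 13) : ℕ) from rfl,
        testBit_maskOf_val, mem_image₂]
      constructor
      · rintro ⟨a, ha, b, hb, e⟩
        refine ⟨b, b.isLt, (testBit_maskOf_val T b).2 hb, ?_⟩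
        have : (⟨(d + b) % 13, Nat.mod_lt _ (by norm_num)⟩ : Fin 13) = a := by
          apply Fin.ext
          rw [Fin.ext_iff, Fin.sub_def] at e
          dsimp only at e ⊢
          omega
        have h3 := (testBit_maskOf_val S a).2 ha
        rw [← this] at h3
        exact h3
      · rintro ⟨b, hb, h1, h2⟩
        refine ⟨⟨(d + b) % 13, Nat.mod_lt _ (by norm_num)⟩, (testBit_maskOf_val S _).1 h2, ⟨b, hb⟩, (testBit_maskOf_val T _).1 h1, ?_⟩
        apply Fin.ext
        rw [Fin.sub_def]
        dsimp only
        omega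
    cases h1 : (maskOf (image₂ (fun a b => a - b) S T)).testBit d <;> cases h2 : (diffMask (maskOf S) (maskOf T)).testBit d
    · rfl
    · exact absurd (key.2 h2) (by rw [h1]; simp)
    · exact absurd (key.1 h1) (by rw [h2]; simp)
    · rfl
  · rw [testBit_eq_false_of_lt13 (maskOf_lt _) (by omega), testBit_eq_false_of_lt13 (diffMask_lt _ _) (by omega)]

/-- **disjoint sets have disjoint masks** -/
theorem land_maskOf_eq_zero {S T : Finset (Fin 13)} (h : Disjoint S T) : Nat.land (maskOf S) (maskOf T) = 0 := by
  apply Nat.eq_of_testBit_eq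
  intro i
  rw [land_def, Nat.testBit_land, Nat.zero_testBit]
  cases h1 : (maskOf S).testBit i <;> cases h2 : (maskOf T).testBit i <;> try rfl
  obtain ⟨x, hx, rfl⟩ := (testBit_maskOf S i).1 h1
  have hx' : x ∈ T := (testBit_maskOf_val T x).1 h2
  exact absurd (Finset.disjoint_left.1 h hx) (not_not.2 hx')

/-- residue `0` outside the set means bit `0` clear -/
theorem testBit_maskOf_zero {S : Finset (Fin 13)} (h : (0 : Fin 13) ∉ S) : (maskOf S).testBit 0 = false := by
  cases h0 : (maskOf S).testBit 0
  · rfl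
  · exact absurd ((testBit_maskOf_val S 0).1 h0) h

end Shape13

end Summit.Ventures.DiscreteObjects.PP12
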